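import Literature.Probability.RandomPlanarGeometry.SAWTriangularDetourSurgery
import HarnessLib

/-!
# Kesten's transfer count (P1) on the triangular lattice

Topic `Literature/Probability/RandomPlanarGeometry` (lane «pcv-sawmu» TRI-RATIO, block P1; imports the base file
`SAWTriangularDetourSurgery.lean`). Source: N. Madras, G. Slade, *The Self-Avoiding Walk* (1993), §7.3, proof of
Theorem 7.3.2, eq. (7.3.6), with the p. 244 Remark (one-step version on the triangular lattice): counting the pairs
(walk, detour slot) of `S_N` against the pairs (walk, sharp turn) of `S_{N+1}` gives
`#{ω' ∈ S_{N+1} : J(ω') ≥ 1} ≤ Σ_{ω ∈ S_N} I(ω)/max(J(ω) − 2, 1)` (`triKesten_P1'`, the shape of hypothesis `hP1`,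
`c₁ = 2`, of `kesten_ineq_of_transfer`) and the partition form `triKesten_P1`.
-/

noncomputable section

open Finset
open Literature.Probability.LatticeModels Literature.Probability.Percolation SimpleGraph

namespace Literature.Probability.RandomPlanarGeometry.SAW

/-! ### (P1) The single transfer: `#{ω' ∈ S_{N+1} : J ≥ 1} ≤ Σ_ω I(ω)/max(J(ω) − 2, 1)` -/

section TransferP1

/-- **(P1), the first counting** (Madras–Slade (7.3.6) with inexact bookkeeping), in the shape of hypothesis
`hP1` (`c₁ = 2`) of the lane's abstract Kesten inequality `kesten_ineq_of_transfer`: the number of `(N+1)`-step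
walks with at least one sharp turn equals `Σ_{(ω,s)} 1/J(ins_s ω)` over the slot pairs of `S_N`, and
`J(ins_s ω) ≥ max(J(ω) − 2, 1)`. [cite: MadrasSlade1993, Theorem 7.3.2 (proof), (7.3.6)] -/
theorem triKesten_P1' (N : ℕ) :
    (#((triSL (N + 1)).filter fun ω' => 1 ≤ #(triSharp ω')) : ℝ) ≤
      ∑ ω ∈ triSL N, (#(triSlots ω) : ℝ) / max ((#(triSharp ω) : ℝ) - 2) 1 := by
  -- the left side is `Σ_{ω'} J(ω') · (1/J(ω'))`, a sum over the sharp-turn pairs of `S_{N+1}`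
  have hJ : (#((triSL (N + 1)).filter fun ω' => 1 ≤ #(triSharp ω')) : ℝ) =
      ∑ ω ∈ triSL (N + 1), (#(triSharp ω) : ℝ) * (1 / (#(triSharp ω) : ℝ)) := by
    rw [card_eq_sum_ones, Nat.cast_sum, sum_filter]
    refine sum_congr rfl fun ω _ => ?_
    by_cases h : 1 ≤ #(triSharp ω)
    · rw [if_pos h, Nat.cast_one, mul_one_div_cancel]
      exact_mod_cast (show #(triSharp ω) ≠ 0 by omega)
    · rw [if_neg h, show #(triSharp ω) = 0 by omega]
      simp
  rw [hJ, ← sum_triSharpPairs (N + 1) (fun ω => 1 / (#(triSharp ω) : ℝ)),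
    ← sum_triSlotPairs_eq_sum_triSharpPairs N (fun p => 1 / (#(triSharp (triIns p.2.1 p.2.2 p.1)) : ℝ))
      (fun q => 1 / (#(triSharp q.1) : ℝ)) (fun p _ => rfl)]
  -- termwise `1/J(ins) ≤ 1/max(J − 2, 1)`, then re-sum over walks
  have hR : ∑ ω ∈ triSL N, (#(triSlots ω) : ℝ) / max ((#(triSharp ω) : ℝ) - 2) 1 =
      ∑ p ∈ triSlotPairs N, 1 / max ((#(triSharp p.1) : ℝ) - 2) 1 := by
    rw [sum_triSlotPairs N (fun ω => 1 / max ((#(triSharp ω) : ℝ) - 2) 1)]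
    refine sum_congr rfl fun ω _ => ?_
    rw [mul_one_div]
  rw [hR]
  refine sum_le_sum fun p hp => ?_
  obtain ⟨ω, m, z⟩ := p
  rw [triSlotPairs, mem_sigma] at hp
  dsimp only at hp ⊢
  obtain ⟨hω, hs⟩ := hp
  obtain ⟨hm, -, -, -⟩ := mem_triSlots.1 hs
  have h1 : (1 : ℝ) ≤ #(triSharp (triIns m z ω)) := by exact_mod_cast one_le_card_triSharp_triIns hω hs
  have h2 : (#(triSharp ω) : ℝ) - 2 ≤ #(triSharp (triIns m z ω)) := by
    have := card_triSharp_le_triIns (z := z) (ω := ω) (le_of_lt hm)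
    have h' : (#(triSharp ω) : ℝ) ≤ #(triSharp (triIns m z ω)) + 2 := by exact_mod_cast this
    linarith
  exact one_div_le_one_div_of_le (lt_of_lt_of_le one_pos (le_max_right _ _)) (max_le h2 h1)

/-- **(P1)** in the lane's partition form (lead g8 r52): `c_{N+1}(𝕋) − #{ω' ∈ S_{N+1} : J(ω') = 0} ≤
Σ_{ω ∈ S_N} I(ω)/max(1, J(ω) − 2)`. [cite: MadrasSlade1993, Theorem 7.3.2 (proof), (7.3.6)] -/
theorem triKesten_P1 (N : ℕ) :
    (triSawCount (N + 1) : ℝ) - #((triSL (N + 1)).filter fun ω => #(triSharp ω) = 0) ≤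
      ∑ ω ∈ triSL N, (#(triSlots ω) : ℝ) / max 1 ((#(triSharp ω) : ℝ) - 2) := by
  have hsplit := card_filter_add_card_filter_not (s := triSL (N + 1)) (p := fun ω => #(triSharp ω) = 0)
  rw [card_triSL] at hsplit
  have hL : (triSawCount (N + 1) : ℝ) - #((triSL (N + 1)).filter fun ω => #(triSharp ω) = 0) =
      #((triSL (N + 1)).filter fun ω' => 1 ≤ #(triSharp ω')) := by
    have h : (triSawCount (N + 1) : ℝ) = #((triSL (N + 1)).filter fun ω => #(triSharp ω) = 0) +
        #((triSL (N + 1)).filter fun ω => ¬#(triSharp ω) = 0) := by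
      exact_mod_cast hsplit.symm
    have e : ((triSL (N + 1)).filter fun ω => ¬#(triSharp ω) = 0) =
        ((triSL (N + 1)).filter fun ω' => 1 ≤ #(triSharp ω')) :=
      filter_congr fun ω _ => by omega
    rw [← e]
    linarith
  rw [hL]
  simp only [max_comm (1 : ℝ)]
  exact triKesten_P1' N

end TransferP1

end Literature.Probability.RandomPlanarGeometry.SAW
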